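import Summits.QuantumFields.GaugeBoot.TiltedBoxLimitClassBTwoDim
import Summits.QuantumFields.GaugeBoot.TiltedBoxEvenAxisRPTwoDim
import HarnessLib

/-!
# Infinite-volume limit points of the 45°-tilted boxes, part 19: every two-dimensional tilted limit point is Class B

HONEST FRAMING (cell `pub-gaugeboot`, page 1 of every file): the venture produces certified bounds
on lattice expectations at stated coupling, gauge group, dimension and torus size; NOT a mass gap,
NOT a continuum limit, NOT a string tension; NOT Yang–Mills-summit-bearing (barriers
`FixedCouplingUltralocality`, `PerturbativeInvisibility`). This module packages structural facts about
the class of infinite-volume Wilson states of TWO-dimensional lattice gauge theory obtained from tilted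
boxes (which SDP constraints are exact for them); it bounds nothing and says nothing about `d ≥ 3`.

## Content

Parts 16–18 left one gap in two dimensions (`∀ k, k = i ∨ k = j`): SITE reflection positivity along the
in-plane axes of a tilted limit point along (frequently) EVEN boxes — on the even box the site mirror
`x_i ↦ -x_i` twists a LAYER and is not of positive type for its closed half (`not_tiltedBox_axisRP`). For the
REDUCED half `{0 ≤ x_i ≤ P - 1}` it is (`TwoDim.tiltedBox_axisRP_even_twoDim`), and a cylinder observable of
`{x_i ≥ 0}` lifts into the reduced half of every large even box (`isRedSiteObservable_axis_comp_tiltedLift`):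

* `siteRP_axis_of_isTiltedBoxLimitAlong_even`, `siteRP_axis'_of_isTiltedBoxLimitAlong_even`,
  **`siteRP_axes_of_mem_tiltedBoxLimitPoints`** — EVERY two-dimensional tilted limit point (every real `β`)
  is site-reflection positive along both in-plane axes (odd family: part 16);
* **`classBStateOfTilted`** / **`exists_classBState_eq_of_mem_tiltedBoxLimitPoints`** — EVERY
  two-dimensional tilted limit point `μ ∈ tiltedBoxLimitPoints d i j ρ β` (`β ≥ 0`, compact Hausdorff second
  countable `G`, continuous `ρ`) is the measure of a `ClassBState d ρ β`: translation / axis-permutation /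
  reflection invariance, the Haar-shift identity, site, link and diagonal RP along every axis and plane;
  `tiltedBoxLimitPoints_subset_classB`, `classB_tilted_fin_two` (literal `d = 2`).

So in two dimensions BOTH routes to infinite volume — cubic tori (`thermodynamicLimitIsClassB_two`, whose
diagonal RP needs the two-dimensional diagonal-RP theorems of the tori) and tilted boxes (diagonal RP exact
in every volume, axis RP recovered in the limit by this series) — land in Class B at every `β ≥ 0`.
Whether the two classes of limit points coincide is the uniqueness question, not touched here.

References: K. Osterwalder, E. Seiler, Ann. Phys. 110 (1978) 440, §2; E. Seiler, LNP 159 (1982) Thm. 2.2;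
J. Fröhlich, R. Israel, E. H. Lieb, B. Simon, J. Stat. Phys. 22 (1980) 297, §3; V. Kazakov, Z. Zheng,
arXiv:2203.11360 §3.1, arXiv:2404.16925 §3.2.
-/

noncomputable section

open MeasureTheory Filter Topology
open scoped ComplexOrder ComplexConjugate
open Literature.Probability.LatticeModels (Site)
open Literature.MathematicalPhysics.QuantumLattice

namespace Summit.QuantumFields.GaugeBoot

namespace TiltedRP

variable {d : ℕ} {i j : Fin d} {N : ℕ}
variable {G : Type*} [Group G] [TopologicalSpace G] [IsTopologicalGroup G] [CompactSpace G]
  [MeasurableSpace G] [BorelSpace G] [SecondCountableTopology G]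
variable (ρ : G →* Matrix (Fin N) (Fin N) ℂ)

/-! ## The site half-space lifts into the reduced half of large even boxes -/

section Halves

variable {L : ℕ} {α : Type*}

omit [Group G] [TopologicalSpace G] [IsTopologicalGroup G] [CompactSpace G] [MeasurableSpace G] [BorelSpace G]
  [SecondCountableTopology G] in
/-- **Site half along the in-plane axis `i`, even box, reduced half.** A cylinder observable supported on
links `T` of the closed half `{x_i ≥ 0}` (`siteHalfEdges i`) with `x_i ≤ m` on `T`, read through the lift,
reads only the links of the REDUCED half `{0 ≤ x_i ≤ P - 1}` (`TwoDim.IsRedSiteLink`) of every even square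
box `M = 2P` with `P ≥ m + 2`. -/
theorem isRedSiteObservable_axis_comp_tiltedLift {P : ℕ} [NeZero P] {F : LGConfig d G → α}
    {T : Finset (ZdEdge d)} (hF : IsCylinder F T) (hT : ∀ e ∈ T, e ∈ siteHalfEdges i) {m : ℕ}
    (hTm : ∀ e ∈ T, e.1 i ≤ m) (hP : m + 2 ≤ P) :
    ∀ U V : Config (TiltedSite d i j (2 * P) (2 * P) L) d G,
      (∀ l, TwoDim.IsRedSiteLink l → U l = V l) →
      F (tiltedLift d i j (2 * P) (2 * P) L U) = F (tiltedLift d i j (2 * P) (2 * P) L V) := by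
  haveI : NeZero (2 * P) := ⟨by have := NeZero.ne P; omega⟩
  intro U V hUV
  refine hF fun e he => ?_
  simp only [tiltedLift_apply]
  have hmem : 0 ≤ e.1 i := hT e he
  have hm := hTm e he
  refine hUV _ ⟨?_, ?_⟩
  · show (axisCoord d L (2 * P) (e.1 : TiltedSite d i j (2 * P) (2 * P) L)).val + 1 ≤ P
    have h := val_axisCoord_mk (L := L) (i := i) (j := j) (M := 2 * P) (x := e.1) hmem (by push_cast; omega)
    omega
  · show (axisCoord d L (2 * P)
        ((e.1 : TiltedSite d i j (2 * P) (2 * P) L) + tiltedUnit d i j (2 * P) (2 * P) L e.2)).val + 1 ≤ P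
    rw [← mk_add_single]
    obtain ⟨h0, h1⟩ := coord_endpoint_bounds (k := i) (e := e) hmem hm
    have h := val_axisCoord_mk (L := L) (j := j) (M := 2 * P) h0 (by push_cast; omega)
    omega

end Halves

/-! ## Box step: the reduced-half positivity read through the lift -/

section Box

variable {M L : ℕ} [NeZero M] [NeZero L]

/-- **Box step, even side, site mirror** (`d = 2`): on the square box of even side `M = 2P`, `P ≥ 2`,
`P ≥ m + 2`, the site RP pairing along `i` of the lift of a bounded measurable cylinder observable of
`{x_i ≥ 0}` with `x_i ≤ m` on its support is non-negative (`TwoDim.tiltedBox_axisRP_even_twoDim`). -/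
theorem box_axisSiteRP_nonneg_even {P : ℕ} [NeZero P] (hM : M = 2 * P) (hP2 : 2 ≤ P) (hij : i ≠ j)
    (hd : ∀ k : Fin d, k = i ∨ k = j) (hρ : Continuous ρ) (β : ℝ) {F : LGConfig d G → ℂ}
    {T : Finset (ZdEdge d)} (hFT : IsCylinder F T) (hFm : Measurable F) {C : ℝ}
    (hC : ∀ U, ‖F U‖ ≤ C) (hT : ∀ e ∈ T, e ∈ siteHalfEdges i) {m : ℕ} (hTm : ∀ e ∈ T, e.1 i ≤ m)
    (hm : m + 2 ≤ P) :
    0 ≤ ∫ U, conj (F (configSiteReflect i (tiltedLift d i j M M L U))) *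
      F (tiltedLift d i j M M L U) ∂(gibbs ρ (tiltedUnit d i j M M L) β) := by
  subst hM
  have hpos := TwoDim.tiltedBox_axisRP_even_twoDim ρ hP2 hij hd hρ β
    (fun U => F (tiltedLift d i j (2 * P) (2 * P) L U))
    (hFm.comp (measurable_tiltedLift d i j _ _ L)) ⟨C, fun U => hC _⟩
    (isRedSiteObservable_axis_comp_tiltedLift hFT hT hTm hm)
  simpa only [tiltedLift_configReflect_axis] using hpos

end Box

/-! ## The site pairing of the limit points, even family -/

/-- **Site pairing along `i`, even family**: if `μ` is the limit along square boxes of EVEN sides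
`M_k + 2 → ∞` (`d = 2`), then `∫ conj F(configSiteReflect i U) F(U) dμ ≥ 0` for every bounded continuous
cylinder observable `F` of `{x_i ≥ 0}` (every real `β`). -/
theorem integral_axisSiteReflect_nonneg_of_cylinder_even (hij : i ≠ j) (hd : ∀ k : Fin d, k = i ∨ k = j)
    (hρ : Continuous ρ) {β : ℝ} {M Q : ℕ → ℕ} {μ : Measure (LGConfig d G)}
    (h : IsTiltedBoxLimitAlong d i j ρ β M Q μ) (hM : Tendsto M atTop atTop)
    (heven : ∀ k, Even (M k + 2)) {F : LGConfig d G → ℂ} {T : Finset (ZdEdge d)}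
    (hFT : IsCylinder F T) (hFc : Continuous F) {C : ℝ} (hC : ∀ U, ‖F U‖ ≤ C)
    (hFS : DependsOn F (siteHalfEdges i)) :
    0 ≤ ∫ U, conj (F (configSiteReflect i U)) * F U ∂μ := by
  classical
  set T' : Finset (ZdEdge d) := T.filter (· ∈ siteHalfEdges (d := d) i) with hT'
  have hFT' : IsCylinder F T' := isCylinder_filter_of_dependsOn hFT hFS
  have hTh : ∀ e ∈ T', e ∈ siteHalfEdges i := fun e he => (Finset.mem_filter.1 he).2
  obtain ⟨m, hm⟩ : ∃ m : ℕ, ∀ e ∈ T', e.1 i ≤ m := by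
    refine ⟨T'.sup fun e => (e.1 i).toNat, fun e he => ?_⟩
    have hle := Finset.le_sup (f := fun e : ZdEdge d => (e.1 i).toNat) he
    have : (e.1 i).toNat ≤ T'.sup fun e : ZdEdge d => (e.1 i).toNat := hle
    omega
  set H : LGConfig d G → ℂ := fun U => conj (F (configSiteReflect i U)) * F U with hH
  have hHc : Continuous H :=
    (Complex.continuous_conj.comp (hFc.comp (continuous_configSiteReflect i))).mul hFc
  obtain ⟨T₁, hT₁⟩ : ∃ T₁ : Finset (ZdEdge d), IsCylinder (F ∘ configSiteReflect i) T₁ :=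
    ⟨_, isCylinder_comp_configSiteReflect hFT i⟩
  have hHcyl : IsCylinder H (T₁ ∪ T) := by
    intro U V hUV
    have e1 := hT₁ fun e he => hUV e (by rw [Finset.coe_union]; exact Or.inl he)
    have e2 := hFT fun e he => hUV e (by rw [Finset.coe_union]; exact Or.inr he)
    simp only [Function.comp_apply] at e1
    simp only [hH, e1, e2]
  have hHb : ∀ U, ‖H U‖ ≤ C * C := fun U => by
    simp only [hH, norm_mul, Complex.norm_conj]
    exact mul_le_mul (hC _) (hC _) (norm_nonneg _) ((norm_nonneg (F U)).trans (hC U))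
  refine h.integral_nonneg_of_eventually hρ hHcyl hHc hHb ?_
  have hev : ∀ᶠ k in atTop, 2 * m + 2 ≤ M k := hM.eventually_ge_atTop (2 * m + 2)
  refine hev.mono fun k hk => ?_
  obtain ⟨P, hP⟩ := heven k
  haveI : NeZero P := ⟨by omega⟩
  exact box_axisSiteRP_nonneg_even ρ (P := P) (by omega) (by omega) hij hd hρ β hFT' hFc.measurable hC
    hTh hm (by omega)

/-! ## Site reflection positivity along the in-plane axes, every family -/

variable [T2Space G]

/-- **Site RP along `i` of a limit point along (frequently) even boxes** (`d = 2`, every real `β`):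
all bounded measurable observables of the closed half `{x_i ≥ 0}`. -/
theorem siteRP_axis_of_isTiltedBoxLimitAlong_even (hij : i ≠ j) (hd : ∀ k : Fin d, k = i ∨ k = j)
    (hρ : Continuous ρ) {β : ℝ} {M Q : ℕ → ℕ} {μ : Measure (LGConfig d G)}
    (h : IsTiltedBoxLimitAlong d i j ρ β M Q μ) (hM : Tendsto M atTop atTop)
    (hQ : Tendsto Q atTop atTop) (heven : ∃ᶠ k in atTop, Even (M k + 2)) :
    IsReflectionPositiveFor (configSiteReflect (G := G) i) (siteHalfEdges i) μ := by
  obtain ⟨φ, hφ, hφeven⟩ := extraction_of_frequently_atTop heven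
  have hμ : μ ∈ tiltedBoxLimitPoints d i j ρ β := ⟨M, Q, hM, hQ, h⟩
  haveI := isProbabilityMeasure_of_mem_tiltedBoxLimitPoints hμ
  exact IsReflectionPositiveFor.of_continuous_cylinder
    (reflectInvariant_of_mem_tiltedBoxLimitPoints ρ hij hρ hμ i)
    fun F T hFT hFc ⟨C, hC⟩ hFS =>
      integral_axisSiteReflect_nonneg_of_cylinder_even ρ hij hd hρ (h.comp_strictMono ρ hφ)
        (hM.comp hφ.tendsto_atTop) hφeven hFT hFc hC hFS

/-- **Site RP along the other in-plane axis `j`** of a limit point along (frequently) even boxes. -/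
theorem siteRP_axis'_of_isTiltedBoxLimitAlong_even (hij : i ≠ j) (hd : ∀ k : Fin d, k = i ∨ k = j)
    (hρ : Continuous ρ) {β : ℝ} {M Q : ℕ → ℕ} {μ : Measure (LGConfig d G)}
    (h : IsTiltedBoxLimitAlong d i j ρ β M Q μ) (hM : Tendsto M atTop atTop)
    (hQ : Tendsto Q atTop atTop) (heven : ∃ᶠ k in atTop, Even (M k + 2)) :
    IsReflectionPositiveFor (configSiteReflect (G := G) j) (siteHalfEdges j) μ :=
  IsReflectionPositiveFor.of_conj
    (measurePreserving_configPerm_swap_of_mem_tiltedBoxLimitPoints ρ hij hρ ⟨M, Q, hM, hQ, h⟩)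
    (measurable_configSiteReflect i) (configPerm_swap_configPerm_swap' i j)
    (configSiteReflect_eq_conj_swap i j) (dependsOn_comp_configPerm_swap_siteHalf i j)
    (siteRP_axis_of_isTiltedBoxLimitAlong_even ρ hij hd hρ h hM hQ heven)

/-- **Site RP along both in-plane axes of a limit point along ANY family of square boxes** (`d = 2`,
every real `β`): the family is frequently odd (part 16) or frequently even (this part). -/
theorem siteRP_axes_of_isTiltedBoxLimitAlong (hij : i ≠ j) (hd : ∀ k : Fin d, k = i ∨ k = j)
    (hρ : Continuous ρ) {β : ℝ} {M Q : ℕ → ℕ} {μ : Measure (LGConfig d G)}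
    (h : IsTiltedBoxLimitAlong d i j ρ β M Q μ) (hM : Tendsto M atTop atTop)
    (hQ : Tendsto Q atTop atTop) :
    IsReflectionPositiveFor (configSiteReflect (G := G) i) (siteHalfEdges i) μ ∧
      IsReflectionPositiveFor (configSiteReflect (G := G) j) (siteHalfEdges j) μ := by
  by_cases hodd : ∃ᶠ k in atTop, Odd (M k + 2)
  · exact ⟨siteRP_axis_of_isTiltedBoxLimitAlong ρ hij hd hρ h hM hQ hodd,
      siteRP_axis'_of_isTiltedBoxLimitAlong ρ hij hd hρ h hM hQ hodd⟩
  · have heven : ∃ᶠ k in atTop, Even (M k + 2) := by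
      rw [not_frequently] at hodd
      exact (hodd.mono fun k hk => Nat.not_odd_iff_even.1 hk).frequently
    exact ⟨siteRP_axis_of_isTiltedBoxLimitAlong_even ρ hij hd hρ h hM hQ heven,
      siteRP_axis'_of_isTiltedBoxLimitAlong_even ρ hij hd hρ h hM hQ heven⟩

/-- **Every two-dimensional tilted limit point is site-reflection positive along BOTH in-plane axes**
(`i ≠ j` exhausting the axes, compact Hausdorff second countable `G`, continuous `ρ`, every real `β`). -/
theorem siteRP_axes_of_mem_tiltedBoxLimitPoints (hij : i ≠ j) (hd : ∀ k : Fin d, k = i ∨ k = j)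
    (hρ : Continuous ρ) {β : ℝ} {μ : Measure (LGConfig d G)} (hμ : μ ∈ tiltedBoxLimitPoints d i j ρ β) :
    IsReflectionPositiveFor (configSiteReflect (G := G) i) (siteHalfEdges i) μ ∧
      IsReflectionPositiveFor (configSiteReflect (G := G) j) (siteHalfEdges j) μ := by
  obtain ⟨M, Q, hM, hQ, h⟩ := hμ
  exact siteRP_axes_of_isTiltedBoxLimitAlong ρ hij hd hρ h hM hQ

/-- **Site RP along every axis of a two-dimensional tilted limit point** (the `siteRP` field of
`ClassBState`, `d = 2`). -/
theorem siteRP_all_of_mem_tiltedBoxLimitPoints (hij : i ≠ j) (hd : ∀ k : Fin d, k = i ∨ k = j)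
    (hρ : Continuous ρ) {β : ℝ} {μ : Measure (LGConfig d G)} (hμ : μ ∈ tiltedBoxLimitPoints d i j ρ β)
    (k : Fin d) : IsReflectionPositiveFor (configSiteReflect (G := G) k) (siteHalfEdges k) μ := by
  obtain ⟨h1, h2⟩ := siteRP_axes_of_mem_tiltedBoxLimitPoints ρ hij hd hρ hμ
  rcases hd k with rfl | rfl
  · exact h1
  · exact h2

/-! ## Every two-dimensional tilted limit point is Class B -/

/-- **The Class-B state of a two-dimensional tilted limit point** (`β ≥ 0`, `i ≠ j` exhausting the axes,
compact Hausdorff second countable `G`, continuous `ρ`): every field of `ClassBState` holds for it. -/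
def classBStateOfTilted (hij : i ≠ j) (hd : ∀ k : Fin d, k = i ∨ k = j) (hρ : Continuous ρ)
    {β : ℝ} (hβ : 0 ≤ β) {μ : Measure (LGConfig d G)} (hμ : μ ∈ tiltedBoxLimitPoints d i j ρ β) :
    ClassBState d ρ β where
  μ := μ
  isProbabilityMeasure := isProbabilityMeasure_of_mem_tiltedBoxLimitPoints hμ
  translationInvariant := isZdTranslationInvariant_of_mem_tiltedBoxLimitPoints ρ hρ hμ
  permInvariant σ := measurePreserving_configPerm_of_mem_tiltedBoxLimitPoints' ρ hij hρ hμ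
    (perm_fix_or_swap_of_two hij hd σ)
  reflectInvariant := reflectInvariant_of_mem_tiltedBoxLimitPoints ρ hij hρ hμ
  haarShift := isHaarShiftState_of_mem_tiltedBoxLimitPoints ρ hρ hμ
  siteRP k := siteRP_all_of_mem_tiltedBoxLimitPoints ρ hij hd hρ hμ k
  linkRP k := linkRP_all_of_mem_tiltedBoxLimitPoints ρ hij hd hρ hμ k
  diagRP a b hab := diagRP_all_of_mem_tiltedBoxLimitPoints ρ hij hd hρ hβ hμ a b hab

/-- The Class-B state of a tilted limit point has that limit point as its measure. -/
@[simp] theorem classBStateOfTilted_μ (hij : i ≠ j) (hd : ∀ k : Fin d, k = i ∨ k = j) (hρ : Continuous ρ)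
    {β : ℝ} (hβ : 0 ≤ β) {μ : Measure (LGConfig d G)} (hμ : μ ∈ tiltedBoxLimitPoints d i j ρ β) :
    (classBStateOfTilted ρ hij hd hρ hβ hμ).μ = μ := rfl

/-- **EVERY two-dimensional tilted limit point is a Class-B state** (`β ≥ 0`). -/
theorem exists_classBState_eq_of_mem_tiltedBoxLimitPoints (hij : i ≠ j) (hd : ∀ k : Fin d, k = i ∨ k = j)
    (hρ : Continuous ρ) {β : ℝ} (hβ : 0 ≤ β) {μ : Measure (LGConfig d G)}
    (hμ : μ ∈ tiltedBoxLimitPoints d i j ρ β) : ∃ ω : ClassBState d ρ β, ω.μ = μ :=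
  ⟨classBStateOfTilted ρ hij hd hρ hβ hμ, rfl⟩

/-- **The two-dimensional tilted limit points form a subclass of Class B** (`β ≥ 0`): as sets of measures,
`tiltedBoxLimitPoints d i j ρ β ⊆ {ω.μ : ω a ClassBState}`. -/
theorem tiltedBoxLimitPoints_subset_classB (hij : i ≠ j) (hd : ∀ k : Fin d, k = i ∨ k = j)
    (hρ : Continuous ρ) {β : ℝ} (hβ : 0 ≤ β) :
    tiltedBoxLimitPoints d i j ρ β ⊆ {μ : Measure (LGConfig d G) | ∃ ω : ClassBState d ρ β, ω.μ = μ} :=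
  fun _ hμ => exists_classBState_eq_of_mem_tiltedBoxLimitPoints ρ hij hd hρ hβ hμ

/-- **The statement on `ℤ²`, literally** (`d = 2`, axes `0`, `1`): at every `β ≥ 0` every limit point of the
Wilson states of the tilted boxes `ℤ²/Γ(M+2, M+2, 2(Q+2))` is a Class-B state of two-dimensional lattice
gauge theory. -/
theorem classB_tilted_fin_two (hρ : Continuous ρ) {β : ℝ} (hβ : 0 ≤ β) {μ : Measure (LGConfig 2 G)}
    (hμ : μ ∈ tiltedBoxLimitPoints 2 (0 : Fin 2) 1 ρ β) : ∃ ω : ClassBState 2 ρ β, ω.μ = μ :=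
  exists_classBState_eq_of_mem_tiltedBoxLimitPoints ρ Fin.zero_ne_one (fun k => by fin_cases k <;> simp) hρ hβ hμ

end TiltedRP

end Summit.QuantumFields.GaugeBoot

end
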